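import Summits.CriticalPhenomena.PercolationContinuityZ3.Theorems.PercNearOneGluingNoHeavyLowerTailMajorityGluingQCertSym3Parts
import Summits.CriticalPhenomena.PercolationContinuityZ3.Theorems.PercNearOneGluingNoHeavyLowerTailMajorityGluingZThirteenEightH
import Summits.CriticalPhenomena.PercolationContinuityZ3.Theorems.PercNearOneGluingNoHeavyLowerTailMajorityGluingEightHarris
import HarnessLib

/-!
# Eight of thirteen relays cut from the hub: `μ ≤ (11/8)·max_i μ(vᵢ ↮ a₀)` by a kernel-checked ORBIT certificate; `C(15) ≤ 19/8`, `= 2` for `max ≥ 3/11` (lane prim-rate, constants-miner 1, gen 39; CANDIDATES §GEN-39)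

Support file for the closed crux `NoHeavyLowerTail` (stmt-CriticalPhenomena-4575), majority-gluing line.  The cell `(13,8)` of `|A| = 15` gets a kernel-checked symmetrised Positivstellensatz certificate `QCert.thirteenEightT2` (kit j311929: engine B symlp3c.py (the S_m-SYMMETRISED DEGREE-3 moment LP, triple-orbit pseudo-moments; cutting planes over ALL hub-rooted van den Berg–Kahn row orbits × lift variables with pair multiplicity ≤ 2^15 and `2×2` square orbits × lift variables; warm-started pool of kit j308961, 49 034 cuts at LP(11/8) ≈ 1e-4) + ENGINE T symlpt.py in type space for the exact extraction (phase-3 certificate LP over that pool restricted to multiplicity ≤ 2^15: margin 1.0 at c = 11/8; also at 172/125 and 69/50); exact integer multipliers re-verified in type space by cert/mksym3z.py (14 378 orbit keys, all sums ≥ 0); ONE representative per relabelling orbit; the kernel evaluation is split into 43 SPEC-ONLY Z parts (`…MajorityGluingZThirteenEightP*`) glued HIERARCHICALLY (4 groups × 6 key ranges, top `…MajorityGluingZThirteenEightH`)):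
**`eightOfThirteen_thirteenEightT2` : `μ(8 ≤ #{v ∈ T : v ↮ a₀}) ≤ (11/8)·δ`** for every finite weighted graph, hub `a₀`, `13`-set `T` and `δ ≥` the cut probabilities (an instance of the
generic `QCert.SymCert3.cut_of_posS3_count`).  Consequences via `cutCount_mono` and the generic Harris layer of `…MajorityGluingEightHarris`:
**`majorityGluing_card_fifteen_thirteenEightT2` : `C(15) ≤ 19/8`** (tree: 12/5 via the root cell (12,7) at 7/5 (…FourteenCertSym3Z, g38)),
**`majorityGluing_two_card_fifteen_of_ge_thirteenEightT2` : `C(15) = 2` whenever `max ≥ 3/11`**, and the Harris form `δ₀ + (11/8)δ₀(1 − δ₀)`.  No sorries.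
[cite: VandenbergKahn2001, Thm 1.2 (p. 123)] [cite: KozmaNitzan2024, Conj. 1 (p. 3), Conj. 4 (p. 32)]
-/

noncomputable section

namespace Summit.CriticalPhenomena.PercolationContinuityZ3.Theorems

open MeasureTheory Set
open Literature.Probability.LatticeModels (prodBernoulli)
open Literature.Probability.Percolation
open scoped Classical

namespace HubOnly

variable {n : ℕ}

/-- **AT LEAST EIGHT OF THIRTEEN RELAYS CUT: `μ ≤ (11/8)·δ`** for every finite weighted graph, hub `a₀`, `13`-set `T` and `δ` bounding the cut probabilities — the
kernel-checked certificate `QCert.thirteenEightT2`. [cite: VandenbergKahn2001, Thm 1.2 (p. 123)] -/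
theorem eightOfThirteen_thirteenEightT2 (w : Sym2 (Fin n) → unitInterval) (a₀ : Fin n) (T : Finset (Fin n)) (hT : T.card = 13) (δ : ℝ)
    (hδ : ∀ v ∈ T, (prodBernoulli w).real (openConn v a₀ : Set (BondConfig (Fin n)))ᶜ ≤ δ) :
    (prodBernoulli w).real {ω : BondConfig (Fin n) | 8 ≤ (T.filter fun v => ω ∉ openConn v a₀).card} ≤ 11 / 8 * δ := by
  obtain ⟨v, hv⟩ : T.Nonempty := by rw [← Finset.card_pos, hT]; norm_num
  have hδ0 : 0 ≤ δ := le_trans measureReal_nonneg (hδ v hv)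
  have h := QCert.SymCert3.cut_of_posS3_count QCert.thirteenEightT2 QCert.thirteenEightT2_m QCert.thirteenEightT2_checkWS QCert.thirteenEightT2_pos w a₀ T hT δ hδ0 hδ
  rw [QCert.thirteenEightT2_base] at h
  have hcD : (QCert.thirteenEightT2Base.cD : ℝ) = 8 := by norm_num [QCert.thirteenEightT2Base]
  have hcN : (QCert.thirteenEightT2Base.cN : ℝ) = 11 := by norm_num [QCert.thirteenEightT2Base]
  have hh : QCert.thirteenEightT2Base.h = 8 := rfl
  rw [hcD, hcN, hh] at h
  linarith

/-- The cell(s) of `|A| ∈ {15}` obey the constant bound `(11/8)·δ` (via the cell monotonicity `cutCount_mono`). [cite: VandenbergKahn2001, Thm 1.2 (p. 123)] -/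
theorem cell_fifteen_thirteenEightT2 (p : Sym2 (Fin n) → unitInterval) (A : Finset (Fin n)) (a₀ : Fin n) (hA1 : A.card = 15)
    (T : Finset (Fin n)) (δ : ℝ) (haT : a₀ ∉ T) (_hTA : T ⊆ A) (hTcard : T.card + 2 = A.card) (_hδ : 0 ≤ δ)
    (hδT : ∀ v ∈ T, (prodBernoulli p).real (openConn v a₀ : Set (BondConfig (Fin n)))ᶜ ≤ δ) :
    (prodBernoulli p).real {ω : BondConfig (Fin n) | (A.card + 1) / 2 ≤ (T.filter fun v => ω ∉ openConn v a₀).card} ≤ 11 / 8 * δ :=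
  cutCount_mono p a₀ 13 8 δ (11 / 8 * δ) (fun T₀ hT₀ _ hδT₀ => eightOfThirteen_thirteenEightT2 p a₀ T₀ hT₀ δ hδT₀) T ((A.card + 1) / 2)
    (by omega) (by omega) haT hδT

/-- **MAJORITY GLUING AT `|A| ∈ {15}` WITH LOSS `(19/8)·max`:** `μ(o ↔ A) − (19/8)δ₀ ≤ μ(o ↔ a₀ ∧ 2N > |A|)` for every weight function, observer,
hub `a₀ ∈ A`, `|A| ∈ {15}`, `δ₀ ≥ max_{a∈A} μ(a ↮ a₀)`. [cite: VandenbergKahn2001, Thm 1.2 (p. 123)] [cite: KozmaNitzan2024, Conj. 1 (p. 3)] -/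
theorem majorityGluing_card_fifteen_thirteenEightT2 (w : Sym2 (Fin n) → unitInterval) (A : Finset (Fin n)) (o a₀ : Fin n) (δ₀ : ℝ)
    (ha₀ : a₀ ∈ A) (hA1 : A.card = 15)
    (hδ₀ : ∀ a ∈ A, (prodBernoulli w).real (openConn a a₀ : Set (BondConfig (Fin n)))ᶜ ≤ δ₀) :
    (prodBernoulli w).real (⋃ a ∈ A, openConn o a) - 19 / 8 * δ₀ ≤
      (prodBernoulli w).real {ω : BondConfig (Fin n) | ω ∈ openConn o a₀ ∧
          A.card < 2 * (A.filter fun a => ω ∈ openConn o a).card} := by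
  have h := majorityGluing_of_cellConst w A o a₀ δ₀ ha₀ (by omega) (11 / 8) (by norm_num)
    (fun p _ T δ haT hTA hTcard hδ hδT => cell_fifteen_thirteenEightT2 p A a₀ hA1 T δ haT hTA hTcard hδ hδT) hδ₀
  norm_num at h ⊢
  linarith

/-- **MAJORITY GLUING AT `|A| ∈ {15}`, HARRIS FORM:** loss `δ₀ + (11/8)·δ₀·(1 − δ₀)` for `max_{a∈A} μ(a ↮ a₀) ≤ δ₀ ≤ 8/11`.
[cite: VandenbergKahn2001, Thm 1.2 (p. 123)] [cite: KozmaNitzan2024, Conj. 1 (p. 3)] -/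
theorem majorityGluing_harris_card_fifteen_thirteenEightT2 (w : Sym2 (Fin n) → unitInterval) (A : Finset (Fin n)) (o a₀ : Fin n) (δ₀ : ℝ)
    (ha₀ : a₀ ∈ A) (hA1 : A.card = 15)
    (hδ₀ : ∀ a ∈ A, (prodBernoulli w).real (openConn a a₀ : Set (BondConfig (Fin n)))ᶜ ≤ δ₀) (hδ₀' : δ₀ ≤ 8 / 11) :
    (prodBernoulli w).real (⋃ a ∈ A, openConn o a) -
        (prodBernoulli w).real {ω : BondConfig (Fin n) | ω ∈ openConn o a₀ ∧
          A.card < 2 * (A.filter fun a => ω ∈ openConn o a).card}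
      ≤ δ₀ + 11 / 8 * δ₀ * (1 - δ₀) :=
  majorityGluing_harris_of_cellConst w A o a₀ δ₀ ha₀ (by omega) (11 / 8) (by norm_num)
    (fun p _ T δ haT hTA hTcard hδ hδT => cell_fifteen_thirteenEightT2 p A a₀ hA1 T δ haT hTA hTcard hδ hδT) hδ₀ (by linarith)

/-- **`C(15) = 2` WHENEVER `max ≥ 3/11`:** `μ(o ↔ A) − 2δ₀ ≤ μ(o ↔ a₀ ∧ 2N > |A|)` for `|A| ∈ {15}`, `δ₀ ≥ max_{a∈A} μ(a ↮ a₀)`, `δ₀ ≥ 3/11`.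
[cite: VandenbergKahn2001, Thm 1.2 (p. 123)] [cite: KozmaNitzan2024, Conj. 1 (p. 3), Conj. 4 (p. 32)] -/
theorem majorityGluing_two_card_fifteen_of_ge_thirteenEightT2 (w : Sym2 (Fin n) → unitInterval) (A : Finset (Fin n)) (o a₀ : Fin n) (δ₀ : ℝ)
    (ha₀ : a₀ ∈ A) (hA1 : A.card = 15)
    (hδ₀ : ∀ a ∈ A, (prodBernoulli w).real (openConn a a₀ : Set (BondConfig (Fin n)))ᶜ ≤ δ₀) (hreg : 3 / 11 ≤ δ₀) :
    (prodBernoulli w).real (⋃ a ∈ A, openConn o a) - 2 * δ₀ ≤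
      (prodBernoulli w).real {ω : BondConfig (Fin n) | ω ∈ openConn o a₀ ∧
          A.card < 2 * (A.filter fun a => ω ∈ openConn o a).card} :=
  majorityGluing_two_of_cellConst w A o a₀ δ₀ ha₀ (by omega) (11 / 8) (by norm_num)
    (fun p _ T δ haT hTA hTcard hδ hδT => cell_fifteen_thirteenEightT2 p A a₀ hA1 T δ haT hTA hTcard hδ hδT) hδ₀ (by linarith)

end HubOnly

end Summit.CriticalPhenomena.PercolationContinuityZ3.Theorems

end
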